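/-
Copyright (c) 2026 the pub-hodgecm-mathlib formalisation cell (harness21).  Prover seat hodgecm-mathlib-K2E1-p12 (g7), Track B ∕ R90-TF, h413 = `stmt-HodgeConjecture-24833`,
R90-TF section S8 «ContSpec-n½», socket (E) :276, E1-PLANCHEREL BODY — the INTERTWINING EXPORTS ROW (S8 dealer R90-CS-plan (g4) S8-R296 (3)): the axis-generic twin of ★
`K2E1OperatorUnitaryAxisOfFE` (axis `Re z = κ`, involution `z ↦ 2κ − z`; `U(2,1)`: `κ = 1`) and the two bridges closing the loop with ★ PB-2d′ `K2E1PseudoEisensteinAxisPoleExclusion`: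
functional equation + adjoint symmetry OFF the candidate set ⇒ norm preservation at the doubly-generic axis points ⇒ coordinate bounds ⇒ no axis poles ⇒ axis continuity `hMc` ⇒
unitarity `hc1` and adjoint reflection `hcs` at EVERY axis point.  Pure analysis + linear algebra, on letters.
-/
import Summits.HodgeConjecture.HodgeConjecture.Theorems.K2E1OperatorUnitaryAxisOfFE               -- ★ D4′c part 3 (K2E4): `eq_of_eventually_nhdsNE_of_continuousAt`; brings ★ A `conj_vertical`
import Summits.HodgeConjecture.HodgeConjecture.Theorems.K2E1PseudoEisensteinAxisPoleExclusion      -- ★ PB-2d′ (this seat): `analyticAt_of_meromorphicNFAt_of_frequently_norm_le`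
import Mathlib.Topology.Algebra.Module.FiniteDimension
import HarnessLib

/-!
# INTERTWINING EXPORTS ROW — `K2E1OperatorUnitaryAxisOfFEAxisGeneric`: `hc1`, `hcs`, `hMc` (and PB-2d′'s axis bounds) of the τ-cut Plancherel chain from the functional equation
# `M(2κ − z)M(z) = 1` and the adjoint symmetry `M(z̄) = M(z)†` OFF a co-discrete candidate set (pure analysis + linear algebra, on letters)

Track B ∕ R90-TF, crux h413 = `stmt-HodgeConjecture-24833`, route of record `HCCMUnconditional`; cell `hodgecm-mathlib`, R90-TF programme, section S8 «ContSpec-n½», socket (E)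
(B ED. 7 :276): the E1-PLANCHEREL BODY at the τ-cut block; PB-2 chain ★ (p865234, p865274, p865294, p865306, p865331, p865367, PB-2d′ p865395).  THEOREMS ONLY (no `def`, no
`instance`, no `notation`, no named-fact hypothesis, no `sorry`; default heartbeats); lane `--supports stmt-HodgeConjecture-24833 --as helper` (count-neutral).  No automorphic object.
CLOSES NO SOCKET.

THE MATHEMATICS ([MoeglinWaldspurger1995, IV.1.10, IV.1.11 (b), proof IV.3.12 ¶1]; [Langlands1976, §7]; [BernsteinLapid2019, §5]).  Axis `Re z = κ` (`κ = 1` for `U(2,1)`, `½` for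
`U(1,1)` = ★ `K2E1OperatorUnitaryAxisOfFE`); on it `2κ − z = z̄ = κ − it`.  The continued intertwining operator `M(z) = M(w₀, z)|_V` of a K-finite block satisfies, OFF a closed co-discrete
candidate set `P`, the FUNCTIONAL EQUATION **(hFE)** `M(2κ − z)(M(z)v) = v` ([MW IV.1.10]; Bernstein–Lapid uniqueness) and the ADJOINT SYMMETRY **(hadj)** `⟪x, M(z)y⟫ = ⟪M(z̄)x, y⟫` (the
`K_U`-pairing; ★ `K2E1IntertwiningAdjoint` in the Godement range + identity theorem).  (§1–§2) At the DOUBLY-GENERIC axis points (`z, z̄ ∉ P` — eventually along `𝓝[≠] t₀` for every `t₀`,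
`P` being co-discrete) this gives `⟪M(z)x, M(z)y⟫ = ⟪M(z̄)M(z)x, y⟫ = ⟪x, y⟫` and `⟪x, M(κ+it)y⟫ = ⟪M(κ−it)x, y⟫`; IF `t ↦ M(κ+it)v` is continuous (**hMc**: no pole ON the axis) both
extend to EVERY `t` (uniqueness of limits, ★ `eq_of_eventually_nhdsNE_of_continuousAt`) — §3 prints them as the `hc1`, `hcs` bytes of ★ `K2E1PseudoEisensteinTwoTermGramAxisGeneric`.
(§4–§5) `hMc` ITSELF follows: norm preservation at the doubly-generic axis points bounds every image `M(z)φ_a` by `‖φ_a‖`; writing `M(z)φ_a = Σ_j qc_j^{(a)}(z)•φ'_j` on LINEARLY INDEPENDENT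
columns (★ exports' (E1) normal form, continued), the coordinates are bounded there (bounded coordinate functionals on the finite-dimensional span, §4 `exists_coordBound_of_linearIndependent`),
hence — being in meromorphic normal form (★ exports) — ANALYTIC at every axis point (★ PB-2d′ `analyticAt_of_meromorphicNFAt_of_frequently_norm_le`, two-sided axis sequence, §5), so
continuous along the axis, and `t ↦ M(κ+it)v` is continuous for every `v` in the span of the generators (§5 `continuous_axis_apply_of_coordFormula`).  §6 HEAD wires the loop:
**`hc1_hcs_hMc_of_fe_of_adj`** — from {hFE, hadj off `P`; exports' normal form + co-discreteness; the coordinate formula on the axis; independent columns; spanning generators} to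
`hc1 ∧ hcs ∧ hMc` in the consumer's bytes.  WHAT STAYS A LETTER (named): the matrix functional equation `hFE` at N = 3 K-type blocks (★ only for the spherical scalar,
`K2E1ScatteringFunctionalEquationCMThree`; L, [BL2019 §5]) and `hadj` off `P` (S–M glue over ★ `K2E1IntertwiningAdjoint`).
* §1 `two_mul_sub_axis_eq_conj`, `inner_map_map_eq_of_fe_of_adj_at`, `tendsto_axisPath_nhdsNE`, `eventually_axis_notMem_axis`.  * §2 `inner_map_map_axis_eq_axis`,
  `inner_map_axis_eq_inner_map_reflect_axis`.  * §3 **`hc1_hcs_of_fe_of_adj_axis`**.  * §4 `exists_coordBound_of_linearIndependent`, `norm_map_axis_le_of_fe_of_adj`,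
  **`axisCoordBound_of_fe_of_adj`**.  * §5 `tendsto_realSeq_nhdsNE`, `analyticAt_axis_of_normBound₂`, `continuous_axis_apply_of_coordFormula`.  * §6 HEAD **`hc1_hcs_hMc_of_fe_of_adj`**.
HONEST LABEL: HC_CM is proved only modulo the 7 printed citations (2 remaining named inputs: hLiu418 = `stmt-HodgeConjecture-24832`, h413 = `stmt-HodgeConjecture-24833`) until rung 0
closes; this file asserts no named fact, closes no socket; count-neutral; `hFE`, `hadj` (off `P`) and the exports' clauses are HYPOTHESES.

## References
* [MoeglinWaldspurger1995] C. Mœglin, J.-L. Waldspurger, *Spectral decomposition and Eisenstein series* (1995), IV.1.10, IV.1.11 (b); IV.3.12 (proof) ¶1, p. 161.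
* [Langlands1976] R. P. Langlands, *On the Functional Equations Satisfied by Eisenstein Series*, LNM 544 (1976), §7.
* [BernsteinLapid2019] J. Bernstein, E. Lapid, *On the meromorphic continuation of Eisenstein series*, J. Amer. Math. Soc. 37 (2024), §5.
-/

set_option autoImplicit false
set_option linter.dupNamespace false  -- the mandated namespace repeats the summit's segment (`HodgeConjecture.HodgeConjecture`)

noncomputable section

open Set Filter Topology Complex Module
open scoped ComplexConjugate InnerProductSpace BigOperators
open Summit.HodgeConjecture.HodgeConjecture.Cruxes.H413.K2E1MellinPaleyWienerHalfLine (conj_vertical)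
open Summit.HodgeConjecture.HodgeConjecture.Cruxes.H413.K2E1OperatorUnitaryAxisOfFE (eq_of_eventually_nhdsNE_of_continuousAt)
open Summit.HodgeConjecture.HodgeConjecture.Cruxes.H413.K2E1PseudoEisensteinAxisPoleExclusion (analyticAt_of_meromorphicNFAt_of_frequently_norm_le)

namespace Summit.HodgeConjecture.HodgeConjecture.Cruxes.H413.K2E1OperatorUnitaryAxisOfFEAxisGeneric

variable {V : Type*} [NormedAddCommGroup V] [InnerProductSpace ℂ V]

/-! ## §1 The generic axis point -/

/-- On the axis `Re z = κ` the involution `z ↦ 2κ − z` is complex conjugation: `2κ − (κ+it) = conj(κ+it) = κ + i(−t)`. [folklore] -/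
theorem two_mul_sub_axis_eq_conj (κ t : ℝ) : 2 * (κ : ℂ) - ((κ : ℂ) + (t : ℂ) * I) = conj ((κ : ℂ) + (t : ℂ) * I) := by
  simp only [map_add, map_mul, Complex.conj_ofReal, Complex.conj_I]
  ring

/-- **FE + ADJOINT SYMMETRY ⇒ UNITARITY AT A POINT WITH `z̄ = w`**: `M(w)(M(z)v) = v`, `⟪x, M(z)y⟫ = ⟪M(z̄)x, y⟫`, `z̄ = w` ⇒ `⟪M(z)x, M(z)y⟫ = ⟪x, y⟫` (★ `inner_map_map_eq_of_fe_of_adj` with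
`1 − z` replaced by `w`). [cite: MoeglinWaldspurger1995, IV.3.12] -/
theorem inner_map_map_eq_of_fe_of_adj_at {M : ℂ → V → V} {z w : ℂ} (hFE : ∀ v : V, M w (M z v) = v) (hadj : ∀ x y : V, ⟪x, M z y⟫_ℂ = ⟪M (conj z) x, y⟫_ℂ)
    (hz : conj z = w) (x y : V) : ⟪M z x, M z y⟫_ℂ = ⟪x, y⟫_ℂ := by
  rw [hadj (M z x) y, hz, hFE x]

/-- **The axis path `t ↦ κ + it` maps punctured neighbourhoods to punctured neighbourhoods** (continuous, injective; κ-twin of ★ P2 `tendsto_axis_nhdsNE`). [folklore] -/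
theorem tendsto_axisPath_nhdsNE (κ t₀ : ℝ) : Tendsto (fun t : ℝ => (κ : ℂ) + (t : ℂ) * I) (𝓝[≠] t₀) (𝓝[≠] ((κ : ℂ) + (t₀ : ℂ) * I)) :=
  (continuous_const.add (continuous_ofReal.mul continuous_const)).continuousWithinAt.tendsto_nhdsWithin fun t ht h => ht (by
    have h' := congrArg Complex.im h
    simpa using h')

/-- **Eventually along the axis the point `κ + it` and its conjugate `κ + i(−t)` (= `2κ − z`) avoid a co-discrete `P`.** [folklore] -/
theorem eventually_axis_notMem_axis {P : Set ℂ} (hPcd : ∀ z₀ : ℂ, ∀ᶠ s in 𝓝[≠] z₀, s ∉ P) (κ t₀ : ℝ) :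
    ∀ᶠ t : ℝ in 𝓝[≠] t₀, ((κ : ℂ) + (t : ℂ) * I) ∉ P ∧ ((κ : ℂ) + ((-t : ℝ) : ℂ) * I) ∉ P := by
  refine ((tendsto_axisPath_nhdsNE κ t₀).eventually (hPcd _)).and ?_
  have hneg : Tendsto (fun t : ℝ => -t) (𝓝[≠] t₀) (𝓝[≠] (-t₀)) :=
    continuous_neg.continuousWithinAt.tendsto_nhdsWithin fun t ht h => ht (neg_injective h)
  exact ((tendsto_axisPath_nhdsNE κ (-t₀)).comp hneg).eventually (hPcd _)

/-! ## §2 Extension to every axis point by continuity -/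

/-- **UNITARITY AT EVERY AXIS POINT**: `⟪M(κ+it)x, M(κ+it)y⟫ = ⟪x, y⟫` for ALL real `t`, from **(hFE)** `M(2κ−z)(M(z)v) = v` and **(hadj)** off a co-discrete `P`, and the axis
continuity **(hcont)** (generically §1, then ★ `eq_of_eventually_nhdsNE_of_continuousAt`). [cite: MoeglinWaldspurger1995, IV.3.12] [cite: Langlands1976, §7] -/
theorem inner_map_map_axis_eq_axis {M : ℂ → V → V} {P : Set ℂ} (hPcd : ∀ z₀ : ℂ, ∀ᶠ s in 𝓝[≠] z₀, s ∉ P) (κ : ℝ)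
    (hFE : ∀ z : ℂ, z ∉ P → 2 * (κ : ℂ) - z ∉ P → ∀ v : V, M (2 * (κ : ℂ) - z) (M z v) = v)
    (hadj : ∀ z : ℂ, z ∉ P → conj z ∉ P → ∀ x y : V, ⟪x, M z y⟫_ℂ = ⟪M (conj z) x, y⟫_ℂ)
    (hcont : ∀ v : V, Continuous fun t : ℝ => M ((κ : ℂ) + (t : ℂ) * I) v) (t : ℝ) (x y : V) :
    ⟪M ((κ : ℂ) + (t : ℂ) * I) x, M ((κ : ℂ) + (t : ℂ) * I) y⟫_ℂ = ⟪x, y⟫_ℂ := by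
  refine eq_of_eventually_nhdsNE_of_continuousAt (F := fun u : ℝ => ⟪M ((κ : ℂ) + (u : ℂ) * I) x, M ((κ : ℂ) + (u : ℂ) * I) y⟫_ℂ) (G := fun _ => ⟪x, y⟫_ℂ)
    (((hcont x).continuousAt).inner ((hcont y).continuousAt)) continuousAt_const ?_
  filter_upwards [eventually_axis_notMem_axis hPcd κ t] with u hu
  have hc : conj ((κ : ℂ) + (u : ℂ) * I) = (κ : ℂ) + ((-u : ℝ) : ℂ) * I := conj_vertical κ u
  have h2 : 2 * (κ : ℂ) - ((κ : ℂ) + (u : ℂ) * I) = (κ : ℂ) + ((-u : ℝ) : ℂ) * I := by rw [two_mul_sub_axis_eq_conj, hc]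
  have hFEu := hFE _ hu.1 (h2 ▸ hu.2)
  rw [h2] at hFEu
  exact inner_map_map_eq_of_fe_of_adj_at hFEu (hadj _ hu.1 (hc ▸ hu.2)) hc x y

/-- **ADJOINT REFLECTION AT EVERY AXIS POINT**: `⟪x, M(κ+it)y⟫ = ⟪M(κ+i(−t))x, y⟫` for ALL real `t` (generically `hadj`, then continuity). [cite: MoeglinWaldspurger1995, IV.1.10] -/
theorem inner_map_axis_eq_inner_map_reflect_axis {M : ℂ → V → V} {P : Set ℂ} (hPcd : ∀ z₀ : ℂ, ∀ᶠ s in 𝓝[≠] z₀, s ∉ P) (κ : ℝ)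
    (hadj : ∀ z : ℂ, z ∉ P → conj z ∉ P → ∀ x y : V, ⟪x, M z y⟫_ℂ = ⟪M (conj z) x, y⟫_ℂ)
    (hcont : ∀ v : V, Continuous fun t : ℝ => M ((κ : ℂ) + (t : ℂ) * I) v) (t : ℝ) (x y : V) :
    ⟪x, M ((κ : ℂ) + (t : ℂ) * I) y⟫_ℂ = ⟪M ((κ : ℂ) + ((-t : ℝ) : ℂ) * I) x, y⟫_ℂ := by
  have h1 : ContinuousAt (fun u : ℝ => ⟪x, M ((κ : ℂ) + (u : ℂ) * I) y⟫_ℂ) t := continuousAt_const.inner ((hcont y).continuousAt)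
  have h2 : ContinuousAt (fun u : ℝ => ⟪M ((κ : ℂ) + ((-u : ℝ) : ℂ) * I) x, y⟫_ℂ) t :=
    (((hcont x).comp continuous_neg).continuousAt).inner continuousAt_const
  refine eq_of_eventually_nhdsNE_of_continuousAt h1 h2 ?_
  filter_upwards [eventually_axis_notMem_axis hPcd κ t] with u hu
  have hc : conj ((κ : ℂ) + (u : ℂ) * I) = (κ : ℂ) + ((-u : ℝ) : ℂ) * I := conj_vertical κ u
  rw [hadj _ hu.1 (hc ▸ hu.2), hc]

/-! ## §3 The `hc1`, `hcs` bytes of ★ `K2E1PseudoEisensteinTwoTermGramAxisGeneric` -/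

/-- **`hc1` ∧ `hcs` AT THE AXIS `κ` FROM (FE) + ADJOINT SYMMETRY + AXIS CONTINUITY** — the byte shapes of ★ `exists_linearIsometry_of_contourShift` ∕ `twoTerm_gram_inner_Lp_of_contourShift`
(consumers pass `fun z => ⇑(M z)`). [cite: MoeglinWaldspurger1995, IV.1.10, IV.3.12] -/
theorem hc1_hcs_of_fe_of_adj_axis {M : ℂ → V → V} {P : Set ℂ} (hPcd : ∀ z₀ : ℂ, ∀ᶠ s in 𝓝[≠] z₀, s ∉ P) (κ : ℝ)
    (hFE : ∀ z : ℂ, z ∉ P → 2 * (κ : ℂ) - z ∉ P → ∀ v : V, M (2 * (κ : ℂ) - z) (M z v) = v)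
    (hadj : ∀ z : ℂ, z ∉ P → conj z ∉ P → ∀ x y : V, ⟪x, M z y⟫_ℂ = ⟪M (conj z) x, y⟫_ℂ)
    (hcont : ∀ v : V, Continuous fun t : ℝ => M ((κ : ℂ) + (t : ℂ) * I) v) :
    (∀ (t : ℝ) (u v : V), ⟪M ((κ : ℂ) + (t : ℂ) * I) u, M ((κ : ℂ) + (t : ℂ) * I) v⟫_ℂ = ⟪u, v⟫_ℂ) ∧
      ∀ (t : ℝ) (u v : V), ⟪u, M ((κ : ℂ) + (t : ℂ) * I) v⟫_ℂ = ⟪M ((κ : ℂ) + ((-t : ℝ) : ℂ) * I) u, v⟫_ℂ :=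
  ⟨fun t u v => inner_map_map_axis_eq_axis hPcd κ hFE hadj hcont t u v, fun t u v => inner_map_axis_eq_inner_map_reflect_axis hPcd κ hadj hcont t u v⟩

/-! ## §4 Coordinate bounds at the doubly-generic axis points -/

/-- **COORDINATE FUNCTIONALS ON THE SPAN OF A LINEARLY INDEPENDENT FINITE FAMILY ARE BOUNDED**: `∃ K ≥ 0, ‖c_j‖ ≤ K·‖Σ_i c_i•φ'_i‖` for all coefficient vectors `c` (finite-dimensional span:
every linear functional is continuous, Mathlib `LinearMap.toContinuousLinearMap`; `Basis.span`). [folklore] -/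
theorem exists_coordBound_of_linearIndependent {ι : Type*} [Fintype ι] {φ' : ι → V} (hli : LinearIndependent ℂ φ') :
    ∃ K : ℝ, 0 ≤ K ∧ ∀ (c : ι → ℂ) (j : ι), ‖c j‖ ≤ K * ‖∑ i, c i • φ' i‖ := by
  classical
  haveI : FiniteDimensional ℂ (Submodule.span ℂ (Set.range φ')) := FiniteDimensional.span_of_finite ℂ (Set.finite_range φ')
  set b : Basis ι ℂ (Submodule.span ℂ (Set.range φ')) := Basis.span hli with hb
  set f : ι → (Submodule.span ℂ (Set.range φ') →L[ℂ] ℂ) := fun j => LinearMap.toContinuousLinearMap (b.coord j) with hf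
  refine ⟨∑ j, ‖f j‖, Finset.sum_nonneg fun j _ => ContinuousLinearMap.opNorm_nonneg (f j), fun c j => ?_⟩
  set w : Submodule.span ℂ (Set.range φ') := b.equivFun.symm c with hw
  have hwsum : w = ∑ i, c i • b i := b.equivFun_symm_apply c
  have hcoe : (w : V) = ∑ i, c i • φ' i := by
    rw [hwsum, Submodule.coe_sum]
    exact Finset.sum_congr rfl fun i _ => by rw [Submodule.coe_smul, hb, Basis.span_apply]
  have hcoord : f j w = c j := by
    have h1 : b.equivFun w = c := b.equivFun.apply_symm_apply c
    rw [hf]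
    dsimp only
    rw [LinearMap.coe_toContinuousLinearMap', Basis.coord_apply, ← Basis.equivFun_apply, h1]
  calc ‖c j‖ = ‖f j w‖ := by rw [hcoord]
    _ ≤ ‖f j‖ * ‖w‖ := (f j).le_opNorm w
    _ ≤ (∑ j, ‖f j‖) * ‖w‖ := mul_le_mul_of_nonneg_right (Finset.single_le_sum (fun j _ => ContinuousLinearMap.opNorm_nonneg (f j)) (Finset.mem_univ j)) (norm_nonneg _)
    _ = (∑ j, ‖f j‖) * ‖∑ i, c i • φ' i‖ := by rw [← hcoe, Submodule.coe_norm]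

/-- **NORM PRESERVATION AT A DOUBLY-GENERIC AXIS POINT**: if `z = κ+it ∉ P` and `z̄ = κ+i(−t) ∉ P` then `‖M(z)x‖ = ‖x‖` ((hFE) + (hadj) at the point, §1; no continuity needed).
[cite: MoeglinWaldspurger1995, IV.3.12] -/
theorem norm_map_axis_eq_of_fe_of_adj {M : ℂ → V → V} {P : Set ℂ} (κ : ℝ)
    (hFE : ∀ z : ℂ, z ∉ P → 2 * (κ : ℂ) - z ∉ P → ∀ v : V, M (2 * (κ : ℂ) - z) (M z v) = v)
    (hadj : ∀ z : ℂ, z ∉ P → conj z ∉ P → ∀ x y : V, ⟪x, M z y⟫_ℂ = ⟪M (conj z) x, y⟫_ℂ)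
    {t : ℝ} (ht : ((κ : ℂ) + (t : ℂ) * I) ∉ P) (ht' : ((κ : ℂ) + ((-t : ℝ) : ℂ) * I) ∉ P) (x : V) : ‖M ((κ : ℂ) + (t : ℂ) * I) x‖ = ‖x‖ := by
  have hc : conj ((κ : ℂ) + (t : ℂ) * I) = (κ : ℂ) + ((-t : ℝ) : ℂ) * I := conj_vertical κ t
  have h2 : 2 * (κ : ℂ) - ((κ : ℂ) + (t : ℂ) * I) = (κ : ℂ) + ((-t : ℝ) : ℂ) * I := by rw [two_mul_sub_axis_eq_conj, hc]
  have hFEt := hFE _ ht (h2 ▸ ht')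
  rw [h2] at hFEt
  have h := inner_map_map_eq_of_fe_of_adj_at hFEt (hadj _ ht (hc ▸ ht')) hc x x
  rw [← sq_eq_sq₀ (norm_nonneg _) (norm_nonneg _), ← inner_self_eq_norm_sq (𝕜 := ℂ), ← inner_self_eq_norm_sq (𝕜 := ℂ), h]

/-- **AXIS COORDINATE BOUNDS FROM (FE) + ADJOINT SYMMETRY**: with the coordinate formula **(hM)** `M(z)φ_a = Σ_j qc_j^{(a)}(z)•φ'_j` on the axis off `P` (★ exports' (E1) normal form,
continued) on LINEARLY INDEPENDENT columns `φ'` (★ exports), norm preservation at the doubly-generic axis points bounds every coordinate there: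
`∃ C, ‖qc_j^{(a)}(κ+it)‖ ≤ C` whenever `κ+it, κ+i(−t) ∉ P` — the axis-bound letter of ★ PB-2d′ in its two-sided form (§5). [cite: MoeglinWaldspurger1995, IV.3.12] -/
theorem axisCoordBound_of_fe_of_adj {ι α : Type*} [Fintype ι] [Fintype α] {φ' : ι → V} (hli : LinearIndependent ℂ φ') (φ : α → V) (qc : α → ι → ℂ → ℂ)
    {M : ℂ → V → V} {P : Set ℂ} (κ : ℝ)
    (hFE : ∀ z : ℂ, z ∉ P → 2 * (κ : ℂ) - z ∉ P → ∀ v : V, M (2 * (κ : ℂ) - z) (M z v) = v)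
    (hadj : ∀ z : ℂ, z ∉ P → conj z ∉ P → ∀ x y : V, ⟪x, M z y⟫_ℂ = ⟪M (conj z) x, y⟫_ℂ)
    (hM : ∀ a (t : ℝ), ((κ : ℂ) + (t : ℂ) * I) ∉ P → M ((κ : ℂ) + (t : ℂ) * I) (φ a) = ∑ j, qc a j ((κ : ℂ) + (t : ℂ) * I) • φ' j) :
    ∃ C : ℝ, ∀ a j (t : ℝ), ((κ : ℂ) + (t : ℂ) * I) ∉ P → ((κ : ℂ) + ((-t : ℝ) : ℂ) * I) ∉ P → ‖qc a j ((κ : ℂ) + (t : ℂ) * I)‖ ≤ C := by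
  obtain ⟨K, hK0, hK⟩ := exists_coordBound_of_linearIndependent hli
  refine ⟨K * ∑ a, ‖φ a‖, fun a j t ht ht' => ?_⟩
  have h1 := hK (fun i => qc a i ((κ : ℂ) + (t : ℂ) * I)) j
  rw [← hM a t ht, norm_map_axis_eq_of_fe_of_adj κ hFE hadj ht ht' (φ a)] at h1
  exact h1.trans (mul_le_mul_of_nonneg_left (Finset.single_le_sum (fun a _ => norm_nonneg (φ a)) (Finset.mem_univ a)) hK0)

/-! ## §5 No axis poles (two-sided axis bound) and the axis continuity `hMc` -/

/-- The real sequence `t₀ + 1∕(n+1)` tends to `t₀` WITHIN the punctured neighbourhood. [folklore] -/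
theorem tendsto_realSeq_nhdsNE (t₀ : ℝ) : Tendsto (fun n : ℕ => t₀ + 1 / ((n : ℝ) + 1)) atTop (𝓝[≠] t₀) := by
  refine tendsto_nhdsWithin_iff.2 ⟨by simpa using tendsto_const_nhds.add (tendsto_one_div_add_atTop_nhds_zero_nat (𝕜 := ℝ)), Eventually.of_forall fun n h => ?_⟩
  have hpos : (0 : ℝ) < 1 / ((n : ℝ) + 1) := by positivity
  have h' : t₀ + 1 / ((n : ℝ) + 1) = t₀ := h
  linarith

/-- **NO POLE ON THE AXIS, TWO-SIDED FORM** (★ PB-2d′ `analyticAt_axis_of_normBound` with the bound asked only where BOTH `κ+it` and `κ+i(−t)` avoid `P`): a function in meromorphic normal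
form on `ℂ` so bounded is analytic at every axis point (the axis sequence `t₀ + 1∕(n+1)` and its mirror are eventually off `P`). [cite: MoeglinWaldspurger1995, IV.1.11, IV.3.12] -/
theorem analyticAt_axis_of_normBound₂ {q : ℂ → ℂ} (hNF : MeromorphicNFOn q univ) {P : Set ℂ} (hPcd : ∀ z₀ : ℂ, ∀ᶠ s in 𝓝[≠] z₀, s ∉ P) (κ : ℝ) {C : ℝ}
    (hb : ∀ t : ℝ, ((κ : ℂ) + (t : ℂ) * I) ∉ P → ((κ : ℂ) + ((-t : ℝ) : ℂ) * I) ∉ P → ‖q ((κ : ℂ) + (t : ℂ) * I)‖ ≤ C) (t₀ : ℝ) :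
    AnalyticAt ℂ q ((κ : ℂ) + (t₀ : ℂ) * I) := by
  have hT := (tendsto_axisPath_nhdsNE κ t₀).comp (tendsto_realSeq_nhdsNE t₀)
  have hev : ∀ᶠ n : ℕ in atTop, ‖q ((κ : ℂ) + ((t₀ + 1 / ((n : ℝ) + 1) : ℝ) : ℂ) * I)‖ ≤ C := by
    filter_upwards [(tendsto_realSeq_nhdsNE t₀).eventually (eventually_axis_notMem_axis hPcd κ t₀)] with n hn
    exact hb _ hn.1 hn.2
  exact analyticAt_of_meromorphicNFAt_of_frequently_norm_le (hNF (mem_univ _)) (hT.frequently hev.frequently)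

/-- **THE AXIS CONTINUITY `hMc` FROM THE COORDINATE FORMULA**: if on the WHOLE axis `M(κ+it)φ_a = Σ_j qc_j^{(a)}(κ+it)•φ'_j` (**hM** — the consumer's definition of the continued operator
on the block) with every coordinate continuous along the axis (§5: analytic there), the generators `φ_a` SPAN `V` and each `M(z)` is linear, then `t ↦ M(κ+it)v` is continuous for every
`v ∈ V` (span induction). [cite: MoeglinWaldspurger1995, IV.1.11] -/
theorem continuous_axis_apply_of_coordFormula {ι α : Type*} [Fintype ι] (φ' : ι → V) (φ : α → V) (qc : α → ι → ℂ → ℂ) (M : ℂ → V →ₗ[ℂ] V) (κ : ℝ)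
    (hM : ∀ a (t : ℝ), M ((κ : ℂ) + (t : ℂ) * I) (φ a) = ∑ j, qc a j ((κ : ℂ) + (t : ℂ) * I) • φ' j)
    (hqc : ∀ a j, Continuous fun t : ℝ => qc a j ((κ : ℂ) + (t : ℂ) * I)) (hspan : Submodule.span ℂ (Set.range φ) = ⊤) (v : V) :
    Continuous fun t : ℝ => M ((κ : ℂ) + (t : ℂ) * I) v := by
  have hv : v ∈ Submodule.span ℂ (Set.range φ) := by rw [hspan]; exact Submodule.mem_top
  induction hv using Submodule.span_induction with
  | mem x hx =>
      obtain ⟨a, rfl⟩ := hx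
      simp_rw [hM a]
      exact continuous_finsetSum _ fun j _ => (hqc a j).smul continuous_const
  | zero => simp_rw [map_zero]; exact continuous_const
  | add x y _ _ hx hy => simp_rw [map_add]; exact hx.add hy
  | smul c x _ hx => simp_rw [map_smul]; exact hx.const_smul c

/-! ## §6 HEAD: the loop closed — `hc1`, `hcs`, `hMc` from (FE) + adjoint symmetry + the exports' clauses -/

/-- **HEAD — `hc1 ∧ hcs ∧ hMc` OF THE τ-CUT PLANCHEREL CHAIN FROM THE FUNCTIONAL EQUATION AND THE ADJOINT SYMMETRY OFF THE CANDIDATE SET.**  Data on a finite-dimensional block `V`: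
generators `φ_a` SPANNING `V`, LINEARLY INDEPENDENT columns `φ'_j` (★ exports), continued coordinates `qc_j^{(a)}` in MEROMORPHIC NORMAL FORM on `ℂ` (★ exports), a co-discrete candidate
set `P` (★ exports), the continued operator `M : ℂ → End V` with the COORDINATE FORMULA on the axis **(hM)** `M(κ+it)φ_a = Σ_j qc_j^{(a)}(κ+it)•φ'_j` (all `t`), the FUNCTIONAL EQUATION
**(hFE)** `M(2κ−z)(M(z)v) = v` and the ADJOINT SYMMETRY **(hadj)** `⟪x, M(z)y⟫ = ⟪M(z̄)x, y⟫`, both for `z` (and its partner) off `P`.  CONCLUSION: **`hc1`** `⟪M(κ+it)u, M(κ+it)v⟫ = ⟪u, v⟫`,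
**`hcs`** `⟪u, M(κ+it)v⟫ = ⟪M(κ+i(−t))u, v⟫` for ALL `t`, and **`hMc`** `t ↦ M(κ+it)v` continuous for all `v` — the three letters of ★ `exists_linearIsometry_of_contourShift` ∕
`twoTerm_gram_inner_Lp_of_contourShift` ∕ `exists_axisModel_representatives` (§4 coordinate bounds at doubly-generic points → §5 no axis poles → continuity → §2–§3).
[cite: MoeglinWaldspurger1995, IV.1.10, IV.1.11, IV.3.12] [cite: Langlands1976, §7] -/
theorem hc1_hcs_hMc_of_fe_of_adj {ι α : Type*} [Fintype ι] [Fintype α] [FiniteDimensional ℂ V] {φ' : ι → V} (hli : LinearIndependent ℂ φ') (φ : α → V)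
    (hspan : Submodule.span ℂ (Set.range φ) = ⊤) (qc : α → ι → ℂ → ℂ) (hNF : ∀ a j, MeromorphicNFOn (qc a j) univ)
    {P : Set ℂ} (hPcd : ∀ z₀ : ℂ, ∀ᶠ s in 𝓝[≠] z₀, s ∉ P) (M : ℂ → V →ₗ[ℂ] V) (κ : ℝ)
    (hM : ∀ a (t : ℝ), M ((κ : ℂ) + (t : ℂ) * I) (φ a) = ∑ j, qc a j ((κ : ℂ) + (t : ℂ) * I) • φ' j)
    (hFE : ∀ z : ℂ, z ∉ P → 2 * (κ : ℂ) - z ∉ P → ∀ v : V, M (2 * (κ : ℂ) - z) (M z v) = v)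
    (hadj : ∀ z : ℂ, z ∉ P → conj z ∉ P → ∀ x y : V, ⟪x, M z y⟫_ℂ = ⟪M (conj z) x, y⟫_ℂ) :
    (∀ (t : ℝ) (u v : V), ⟪M ((κ : ℂ) + (t : ℂ) * I) u, M ((κ : ℂ) + (t : ℂ) * I) v⟫_ℂ = ⟪u, v⟫_ℂ) ∧
      (∀ (t : ℝ) (u v : V), ⟪u, M ((κ : ℂ) + (t : ℂ) * I) v⟫_ℂ = ⟪M ((κ : ℂ) + ((-t : ℝ) : ℂ) * I) u, v⟫_ℂ) ∧
      ∀ v : V, Continuous fun t : ℝ => M ((κ : ℂ) + (t : ℂ) * I) v := by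
  -- §4: coordinate bounds at the doubly-generic axis points
  obtain ⟨C, hC⟩ := axisCoordBound_of_fe_of_adj (M := fun z => ⇑(M z)) hli φ qc κ hFE hadj (fun a t _ => hM a t)
  -- §5: no axis poles ⇒ coordinates continuous along the axis ⇒ `hMc`
  have hpath : Continuous fun u : ℝ => (κ : ℂ) + (u : ℂ) * I := continuous_const.add (continuous_ofReal.mul continuous_const)
  have hqc : ∀ a j, Continuous fun t : ℝ => qc a j ((κ : ℂ) + (t : ℂ) * I) := fun a j => by
    refine continuous_iff_continuousAt.2 fun t => ?_
    have hA := (analyticAt_axis_of_normBound₂ (hNF a j) hPcd κ (fun t ht ht' => hC a j t ht ht') t).continuousAt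
    exact ContinuousAt.comp (f := fun u : ℝ => (κ : ℂ) + (u : ℂ) * I) hA hpath.continuousAt
  have hMc : ∀ v : V, Continuous fun t : ℝ => M ((κ : ℂ) + (t : ℂ) * I) v := continuous_axis_apply_of_coordFormula φ' φ qc M κ hM hqc hspan
  -- §2–§3: extension to every axis point
  obtain ⟨h1, h2⟩ := hc1_hcs_of_fe_of_adj_axis (M := fun z => ⇑(M z)) hPcd κ hFE hadj hMc
  exact ⟨h1, h2, hMc⟩

end Summit.HodgeConjecture.HodgeConjecture.Cruxes.H413.K2E1OperatorUnitaryAxisOfFEAxisGeneric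

end
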